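import Summits.BirchSwinnertonDyer.BirchSwinnertonDyer.Theorems.ResidualThetaTransportAtTwoSignedMuVanishingAtTwoPlusCuspSpanGenerationTwoPrimesTools
import HarnessLib

/-!
# Node (G′)_N = `CuspSpanEvenAtTwo N` (item 27436; cruxes Kμ⁺ 20689 / Kan⁺ 20688 / 21437): GENERATION WITH ROWS `|b| ≤ 2` AT EVERY
# LEVEL WITH AT MOST TWO PRIMES, AND WITH ROWS `|b| ≤ 3` AT EVERY ODD LEVEL WITH AT MOST THREE PRIMES — uniformly, no certificate

Cell `bsd-wall`, lead `bsd-wall-rtt-p4` g9 (crux Kμ⁺ stmt-BirchSwinnertonDyer-20689, line `birth`, stub `stub_flatMuZeroAtTwo` ⟸ node 27436).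
THEOREMS ONLY (no `def`, no named fact, no `sorry`); helper `--supports` the crux; BSD is not proved by this. Sequel of
`…CuspSpanGenerationTwoPrimes` (`B₁`-generation at `p^a q`, `a ≤ 2`). The «rows» of rtt-p4-w2 g6's composite data (STATUS 13:48:01Z:
`B₁` alone spans `H₁(X₀(N); 𝔽₂)` exactly at `p^e, pq, pq²`; more rows `B_m = {|b| = m}` are needed beyond) are explained and bounded:

THEOREM (`Rows.chi_eq_zero_of_forall_b_le_two`). If `N ≥ 2` has at most two prime factors (`N = p^a q^b`), every additive `χ : Γ₀(N) → ZMod 2`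
killing the elements of trace `0, ±1, ±2` and the elements with `1 ≤ |b| ≤ 2` vanishes identically.
THEOREM (`Rows.chi_eq_zero_of_forall_b_le_three`). If `N` is ODD with at most three prime factors, the same holds with `1 ≤ |b| ≤ 3`.
(Exact 𝔽₂ numerics, this seat's `compute/bmspan.py`, agree and show both are sharp: rows ≤ 1 fail at 135 = 3³·5 (22/26) but rows ≤ 2 span at
135, 189, 225, 297, 375, 441; rows ≤ 2 fail at 105, 165, 195, 255 (co-dimension 2) but rows ≤ 3 span at 105, 165, 195, 255, 315, 385.)

PROOF (one template, `Rows.chi_eq_zero_of_step`). Induct on `|d(γ)|`; the column `x = (b, d)` has Farey parents `y = (b′, d′)`, `y′ = x − y`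
(`b d′ − d b′ = 1`, `0 < d′, d − d′ < d`). Columns at determinant `e` apart differ by an element with `|b| = |e|` (`γ⁻¹γ′`, the Farey transfer
of the Tools file, here for `|e| ≤ M`). A good parent transfers at `|e| = 1`. If BOTH parents are bad, their `d`'s are coprime, so the primes
of `N` dividing `d′` (set `S′ ≠ ∅`) and those dividing `d − d′` (`S″ ≠ ∅`) are disjoint; a combination `z = u·y′ − v·y` has `d_z = u(d−d′) − v d′`
and `det`-distance `u + v` from `x`. With at most two primes there is no third prime and `z = y′ − y` (`u = v = 1`) is good, `|d_z| < d`: rows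
`≤ 2`. With a third prime `r` (dividing neither), `y′ − y` is good unless `r ∣ d − 2d′`; then (`N` odd, so `2 ∉ S′ ∪ S″`) `y′ − 2y` is good and
short when `d′ < 2(d − d′)`, and `2y′ − y` is good and short otherwise: rows `≤ 3`.

WHAT THIS MEANS FOR THE NODE. By rtt-p3-w4 g2's `…CuspSpanCharacterOdd` the node at odd `N` is «admissible `χ` vanishing on `B₁` vanishes»;
so at `N = p^a q^b` it is EXACTLY «an admissible `χ` vanishing on `B₁` vanishes on `B₂`» and at `ω(N) = 3` «… vanishes on `B₂ ∪ B₃`» — the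
`4^k`-classes (`S₄`) must supply precisely that (they do numerically: (T_N) certificates, rtt-p3 g9). Nothing about it is asserted here.

References: R. S. Kulkarni, Amer. J. Math. 113 (1991) 1053–1133 [Kulkarni1991]; H. Rademacher, Abh. Math. Sem. Hamburg 7 (1929) [Rademacher1929];
R. Pollack, Duke Math. J. 118 (2003) Conj. 6.3 [Pollack2003].
-/

set_option autoImplicit false
set_option linter.dupNamespace false

open scoped MatrixGroups

open CongruenceSubgroup

namespace Summit.BirchSwinnertonDyer.BirchSwinnertonDyer.Theorems.SignedMuAtTwo

namespace Rows

variable {N : ℕ} {χ : Gamma0 N → ZMod 2}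

/-! ## §1. Transfer at determinant distance `≤ M`; coprimality from primes -/

/-- **Transfer at distance `≤ M`.** If the second columns `(b, d)`, `(b′, d′)` of `γ, γ′ ∈ Γ₀(N)` satisfy `|d b′ − b d′| ≤ M` and the additive
`χ` kills the small-trace elements and every element with `1 ≤ |b| ≤ M`, then `χ γ = χ γ′` (`γ⁻¹γ′` has upper-right entry `d b′ − b d′`).
[cite: Kulkarni1991, §2] -/
theorem chi_eq_of_secondCol_le (M : ℕ) (hadd : ∀ γ δ : Gamma0 N, χ (γ * δ) = χ γ + χ δ)
    (hsmall : ∀ γ : Gamma0 N, ((γ : SL(2, ℤ)) 0 0 + (γ : SL(2, ℤ)) 1 1).natAbs ≤ 2 → χ γ = 0)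
    (hB : ∀ β : Gamma0 N, 1 ≤ ((β : SL(2, ℤ)) 0 1).natAbs → ((β : SL(2, ℤ)) 0 1).natAbs ≤ M → χ β = 0) (γ γ' : Gamma0 N)
    (hdet : ((γ : SL(2, ℤ)) 1 1 * (γ' : SL(2, ℤ)) 0 1 - (γ : SL(2, ℤ)) 0 1 * (γ' : SL(2, ℤ)) 1 1).natAbs ≤ M) :
    χ γ = χ γ' := by
  obtain ⟨e01, e11, e00⟩ := TwoPrimes.inv_mul_entries γ γ'
  have hβ : χ (γ⁻¹ * γ') = 0 := by
    rcases Nat.lt_or_ge (((γ : SL(2, ℤ)) 1 1 * (γ' : SL(2, ℤ)) 0 1 -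
        (γ : SL(2, ℤ)) 0 1 * (γ' : SL(2, ℤ)) 1 1).natAbs) 1 with h0 | h1
    · -- equal columns: `γ⁻¹γ'` is `(±1 0; * ±1)`
      have hz : (γ : SL(2, ℤ)) 1 1 * (γ' : SL(2, ℤ)) 0 1 - (γ : SL(2, ℤ)) 0 1 * (γ' : SL(2, ℤ)) 1 1 = 0 :=
        Int.natAbs_eq_zero.mp (by omega)
      have hdetβ := Matrix.SpecialLinearGroup.det_coe ((γ⁻¹ * γ' : Gamma0 N) : SL(2, ℤ))
      rw [Matrix.det_fin_two, e01, hz, zero_mul, sub_zero] at hdetβ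
      refine hsmall _ ?_
      rcases Int.eq_one_or_neg_one_of_mul_eq_one' hdetβ with ⟨h1, h2⟩ | ⟨h1, h2⟩ <;> rw [h1, h2] <;> rfl
    · exact hB _ (by rw [e01]; exact h1) (by rw [e01]; exact hdet)
  have h := hadd γ (γ⁻¹ * γ')
  rw [mul_inv_cancel_left, hβ, add_zero] at h
  exact h.symm

/-- Coprimality from primes: if no prime divisor of `n` divides `d` then `d` is prime to `n`. [folklore] -/
theorem isCoprime_of_forall_prime {d : ℤ} {n : ℕ} (h : ∀ ℓ : ℕ, ℓ.Prime → ℓ ∣ n → ¬ (ℓ : ℤ) ∣ d) : IsCoprime d (n : ℤ) := by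
  rw [Int.isCoprime_iff_gcd_eq_one]
  by_contra hg
  obtain ⟨ℓ, hℓ, hℓg⟩ := Nat.exists_prime_and_dvd hg
  have h1 : (ℓ : ℤ) ∣ d := (Int.natCast_dvd_natCast.mpr hℓg).trans (Int.gcd_dvd_left d (n : ℤ))
  have h2 : ℓ ∣ n := by
    have := (Int.natCast_dvd_natCast.mpr hℓg).trans (Int.gcd_dvd_right d (n : ℤ))
    exact_mod_cast this
  exact h ℓ hℓ h2 h1

/-- A bad residue has a prime witness: if `d` is not prime to `n` then some prime divisor of `n` divides `d`. [folklore] -/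
theorem exists_prime_dvd_of_not_isCoprime {d : ℤ} {n : ℕ} (h : ¬ IsCoprime d (n : ℤ)) :
    ∃ ℓ : ℕ, ℓ.Prime ∧ ℓ ∣ n ∧ (ℓ : ℤ) ∣ d := by
  by_contra hne
  push Not at hne
  exact h (isCoprime_of_forall_prime fun ℓ hℓ hℓn ↦ hne ℓ hℓ hℓn)

/-- A prime dividing `d` and `n` witnesses that `d` is not prime to `n`. [folklore] -/
theorem not_isCoprime_of_prime_dvd {d : ℤ} {n : ℕ} {ℓ : ℕ} (hℓ : ℓ.Prime) (hn : ℓ ∣ n) (hd : (ℓ : ℤ) ∣ d) : ¬ IsCoprime d (n : ℤ) :=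
  fun h ↦ (Nat.prime_iff_prime_int.mp hℓ).not_unit (h.isUnit_of_dvd' hd (Int.natCast_dvd_natCast.mpr hn))

/-! ## §2. The descent template: a both-bad-parents STEP at determinant distance `≤ M` gives `χ = 0` -/

/-- **Descent template.** Let `N ≥ 2`, `M ≥ 1`, and suppose that for every good column `(b, d)` (`d ≥ 2`, `d` prime to `N`) with Farey parent
data `b d′ − d b′ = 1`, `0 < d′ < d`, BOTH parents bad, there is a good primitive column `(b_z, d_z)` with `|d_z| < d` at determinant
distance `|d_z b − b_z d| ≤ M` from `(b, d)`. Then every additive `χ` killing the small-trace elements and the elements with `1 ≤ |b| ≤ M`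
vanishes on `Γ₀(N)`. [cite: Kulkarni1991, §2] -/
theorem chi_eq_zero_of_step (hN2 : 2 ≤ N) (M : ℕ) (hM : 1 ≤ M)
    (hstep : ∀ b d b' d' : ℤ, 2 ≤ d → 0 < d' → d' < d → b * d' - d * b' = 1 → IsCoprime d (N : ℤ) →
      ¬ IsCoprime d' (N : ℤ) → ¬ IsCoprime (d - d') (N : ℤ) →
      ∃ bz dz : ℤ, IsCoprime bz dz ∧ IsCoprime dz (N : ℤ) ∧ dz.natAbs < d.natAbs ∧ (dz * b - bz * d).natAbs ≤ M)
    (hadd : ∀ γ δ : Gamma0 N, χ (γ * δ) = χ γ + χ δ)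
    (hsmall : ∀ γ : Gamma0 N, ((γ : SL(2, ℤ)) 0 0 + (γ : SL(2, ℤ)) 1 1).natAbs ≤ 2 → χ γ = 0)
    (hB : ∀ β : Gamma0 N, 1 ≤ ((β : SL(2, ℤ)) 0 1).natAbs → ((β : SL(2, ℤ)) 0 1).natAbs ≤ M → χ β = 0) :
    ∀ γ : Gamma0 N, χ γ = 0 := by
  have hB1 : ∀ β : Gamma0 N, ((β : SL(2, ℤ)) 0 1).natAbs = 1 → χ β = 0 := fun β hb ↦ hB β (by omega) (by omega)
  suffices h : ∀ n : ℕ, ∀ γ : Gamma0 N, ((γ : SL(2, ℤ)) 1 1).natAbs = n → χ γ = 0 from fun γ ↦ h _ γ rfl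
  intro n
  induction n using Nat.strong_induction_on with
  | _ n ih =>
  have core : ∀ γ : Gamma0 N, 0 < (γ : SL(2, ℤ)) 1 1 → ((γ : SL(2, ℤ)) 1 1).natAbs = n → χ γ = 0 := by
    intro γ hdpos hn
    set b := (γ : SL(2, ℤ)) 0 1 with hbdef
    set d := (γ : SL(2, ℤ)) 1 1 with hddef
    rcases Nat.lt_or_ge n 2 with hlt | hge
    · exact TwoPrimes.chi_eq_zero_of_natAbs_d_le_one hN2 hadd hsmall γ (by rw [← hddef, hn]; omega)
    · have hd2 : 2 ≤ d := by omega
      have hdet : (γ : SL(2, ℤ)) 0 0 * d - b * (γ : SL(2, ℤ)) 1 0 = 1 := by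
        have := Matrix.SpecialLinearGroup.det_coe (γ : SL(2, ℤ))
        rwa [Matrix.det_fin_two] at this
      have hgood : IsCoprime d (N : ℤ) := by
        have h := (ZMod.coe_int_isUnit_iff_isCoprime d N).mp (by rw [hddef]; exact isUnit_gamma0_apply_one_one γ)
        exact h.symm
      have hcop : IsCoprime b d := ⟨-(γ : SL(2, ℤ)) 1 0, (γ : SL(2, ℤ)) 0 0, by linear_combination hdet⟩
      obtain ⟨u, v, huv⟩ := hcop
      set k := u / d with hkdef
      set d' := u % d with hd'def
      set b' := -v - k * b with hb'def
      have hud : d * k + d' = u := Int.mul_ediv_add_emod u d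
      have hdet' : b * d' - d * b' = 1 := by
        rw [hb'def]
        have : d' = u - d * k := by linear_combination hud
        rw [this]
        linear_combination huv
      have hd'nn : 0 ≤ d' := Int.emod_nonneg _ (by omega)
      have hd'lt : d' < d := Int.emod_lt_of_pos _ (by omega)
      have hd'pos : 0 < d' := by
        rcases lt_or_eq_of_le hd'nn with h | h
        · exact h
        · exfalso
          rw [← h, mul_zero, zero_sub] at hdet'
          have h1 := congrArg Int.natAbs hdet'
          rw [Int.natAbs_neg, Int.natAbs_mul] at h1
          have := Nat.eq_one_of_mul_eq_one_right (by simpa using h1)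
          omega
      have hcop_y : IsCoprime b' d' := ⟨-d, b, by linear_combination hdet'⟩
      have hcop_y' : IsCoprime (b - b') (d - d') := ⟨d', -b', by linear_combination hdet'⟩
      by_cases hgy : IsCoprime d' (N : ℤ)
      · obtain ⟨γy, hy01, hy11⟩ := TwoPrimes.exists_gamma0_secondCol (N := N) b' d' hcop_y hgy
        have hχy : χ γy = 0 := ih d'.natAbs (by rw [← hn]; omega) γy (by rw [hy11])
        rw [← hχy]
        refine (TwoPrimes.chi_eq_of_secondCol hadd hsmall hB1 γy γ ?_).symm
        rw [hy01, hy11, ← hbdef, ← hddef]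
        have : d' * b - b' * d = 1 := by linear_combination hdet'
        rw [this]; rfl
      by_cases hgy' : IsCoprime (d - d') (N : ℤ)
      · obtain ⟨γy, hy01, hy11⟩ := TwoPrimes.exists_gamma0_secondCol (N := N) (b - b') (d - d') hcop_y' hgy'
        have hχy : χ γy = 0 := ih (d - d').natAbs (by rw [← hn]; omega) γy (by rw [hy11])
        rw [← hχy]
        refine (TwoPrimes.chi_eq_of_secondCol hadd hsmall hB1 γy γ ?_).symm
        rw [hy01, hy11, ← hbdef, ← hddef]
        have : (d - d') * b - (b - b') * d = -1 := by linear_combination (-1 : ℤ) * hdet'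
        rw [this]; rfl
      -- both parents bad: the supplied step
      obtain ⟨bz, dz, hcz, hgz, hlt, hdist⟩ := hstep b d b' d' hd2 hd'pos hd'lt hdet' hgood hgy hgy'
      obtain ⟨γz, hz01, hz11⟩ := TwoPrimes.exists_gamma0_secondCol (N := N) bz dz hcz hgz
      have hχz : χ γz = 0 := ih dz.natAbs (by rw [← hn]; exact hlt) γz (by rw [hz11])
      rw [← hχz]
      refine (chi_eq_of_secondCol_le M hadd hsmall hB γz γ ?_).symm
      rw [hz01, hz11, ← hbdef, ← hddef]
      exact hdist
  intro γ hn
  rcases lt_trichotomy ((γ : SL(2, ℤ)) 1 1) 0 with hneg | hzero | hpos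
  · obtain ⟨γ', -, h11, hχ⟩ := TwoPrimes.exists_neg hadd hsmall γ
    rw [← hχ]
    exact core γ' (by rw [h11]; omega) (by rw [h11, Int.natAbs_neg, hn])
  · exact TwoPrimes.chi_eq_zero_of_natAbs_d_le_one hN2 hadd hsmall γ (by rw [hzero]; simp)
  · exact core γ hpos hn

/-! ## §3. At most two primes: rows `|b| ≤ 2` -/

/-- **GENERATION WITH ROWS `≤ 2` AT `N = p^a q^b`.** If `N ≥ 2` has at most two prime factors (`p, q` primes with every prime factor of `N`
among them; `p = q` allowed), then every additive `χ : Γ₀(N) → ZMod 2` killing the elements of trace `0, ±1, ±2` and the elements with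
`1 ≤ |b| ≤ 2` vanishes identically. (Step: both parents bad ⟹ `p ∣ d′`, `q ∣ d − d′` up to swapping, so `z = y′ − y` is good at determinant
distance `2`.) Sharp: rows `≤ 1` fail at `135` (exact 𝔽₂ numerics). [cite: Kulkarni1991, §2] [cite: Rademacher1929, §1] -/
theorem chi_eq_zero_of_forall_b_le_two (hN2 : 2 ≤ N) {p q : ℕ} (hp : p.Prime) (hq : q.Prime)
    (hpq : ∀ ℓ : ℕ, ℓ.Prime → ℓ ∣ N → ℓ = p ∨ ℓ = q)
    (hadd : ∀ γ δ : Gamma0 N, χ (γ * δ) = χ γ + χ δ)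
    (hsmall : ∀ γ : Gamma0 N, ((γ : SL(2, ℤ)) 0 0 + (γ : SL(2, ℤ)) 1 1).natAbs ≤ 2 → χ γ = 0)
    (hB : ∀ β : Gamma0 N, 1 ≤ ((β : SL(2, ℤ)) 0 1).natAbs → ((β : SL(2, ℤ)) 0 1).natAbs ≤ 2 → χ β = 0) :
    ∀ γ : Gamma0 N, χ γ = 0 := by
  refine chi_eq_zero_of_step hN2 2 one_le_two ?_ hadd hsmall hB
  intro b d b' d' hd2 hd'pos hd'lt hdet' _ hgy hgy'
  -- the common-prime exclusion
  have key : ∀ ℓ : ℕ, ℓ.Prime → (ℓ : ℤ) ∣ d' → (ℓ : ℤ) ∣ d - d' → False := by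
    intro ℓ hℓ h1 h2
    have hcop : IsCoprime d' (d - d') := ⟨b - b', -b', by linear_combination hdet'⟩
    exact (Nat.prime_iff_prime_int.mp hℓ).not_unit (hcop.isUnit_of_dvd' h1 h2)
  obtain ⟨ℓ₁, hℓ₁, hℓ₁N, hℓ₁d⟩ := exists_prime_dvd_of_not_isCoprime hgy
  obtain ⟨ℓ₂, hℓ₂, hℓ₂N, hℓ₂d⟩ := exists_prime_dvd_of_not_isCoprime hgy'
  refine ⟨b - 2 * b', d - 2 * d', ⟨d', -b', by linear_combination hdet'⟩, ?_, by omega, ?_⟩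
  · -- `z = y' - y` is good: every prime of `N` is `ℓ₁` or `ℓ₂` up to the two names `p, q`
    refine isCoprime_of_forall_prime fun ℓ hℓ hℓN hℓz ↦ ?_
    -- `ℓ` divides `d'` or `d - d'`: it is one of `p, q`, and so are `ℓ₁ ≠ ℓ₂`
    have hne : ℓ₁ ≠ ℓ₂ := fun h ↦ key ℓ₁ hℓ₁ hℓ₁d (h ▸ hℓ₂d)
    have hℓ12 : ℓ = ℓ₁ ∨ ℓ = ℓ₂ := by
      rcases hpq ℓ hℓ hℓN with rfl | rfl <;> rcases hpq ℓ₁ hℓ₁ hℓ₁N with h1 | h1 <;>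
        rcases hpq ℓ₂ hℓ₂ hℓ₂N with h2 | h2 <;> first | exact Or.inl h1.symm | exact Or.inr h2.symm | exact (hne (h1.trans h2.symm)).elim
    rcases hℓ12 with rfl | rfl
    · -- `ℓ ∣ d'` and `ℓ ∣ d - 2d'` give `ℓ ∣ d - d'`
      exact key ℓ hℓ hℓ₁d (by have := dvd_add hℓz hℓ₁d; rwa [show d - 2 * d' + d' = d - d' by ring] at this)
    · exact key ℓ hℓ (by have := dvd_sub hℓ₂d hℓz; rwa [show d - d' - (d - 2 * d') = d' by ring] at this) hℓ₂d
  · have : (d - 2 * d') * b - (b - 2 * b') * d = -2 := by linear_combination (-2 : ℤ) * hdet'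
    rw [this]; rfl

/-! ## §4. Odd level with at most three primes: rows `|b| ≤ 3` -/

/-- **GENERATION WITH ROWS `≤ 3` AT ODD `N` WITH `ω(N) ≤ 3`.** If `N` is odd and every prime factor of `N` is among the primes `p, q, r`
(coincidences allowed), then every additive `χ : Γ₀(N) → ZMod 2` killing the elements of trace `0, ±1, ±2` and the elements with
`1 ≤ |b| ≤ 3` vanishes identically. (Step: if the third prime divides `d − 2d′`, use `y′ − 2y` when `d′ < 2(d − d′)` and `2y′ − y` otherwise —
odd primes never divide the coefficients `1, 2`.) Sharp: rows `≤ 2` fail at `105, 165, 195, 255` (exact 𝔽₂ numerics, co-dimension `2`).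
[cite: Kulkarni1991, §2] [cite: Rademacher1929, §1] -/
theorem chi_eq_zero_of_forall_b_le_three (hN2 : 2 ≤ N) (hodd : Odd N) {p q r : ℕ} (hp : p.Prime) (hq : q.Prime) (hr : r.Prime)
    (hpqr : ∀ ℓ : ℕ, ℓ.Prime → ℓ ∣ N → ℓ = p ∨ ℓ = q ∨ ℓ = r)
    (hadd : ∀ γ δ : Gamma0 N, χ (γ * δ) = χ γ + χ δ)
    (hsmall : ∀ γ : Gamma0 N, ((γ : SL(2, ℤ)) 0 0 + (γ : SL(2, ℤ)) 1 1).natAbs ≤ 2 → χ γ = 0)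
    (hB : ∀ β : Gamma0 N, 1 ≤ ((β : SL(2, ℤ)) 0 1).natAbs → ((β : SL(2, ℤ)) 0 1).natAbs ≤ 3 → χ β = 0) :
    ∀ γ : Gamma0 N, χ γ = 0 := by
  have h2N : ¬ (2 : ℕ) ∣ N := fun h ↦ (Nat.not_even_iff_odd.mpr hodd) (even_iff_two_dvd.mpr h)
  refine chi_eq_zero_of_step hN2 3 (by norm_num) ?_ hadd hsmall hB
  intro b d b' d' hd2 hd'pos hd'lt hdet' hgood hgy hgy'
  have hcop12 : IsCoprime d' (d - d') := ⟨b - b', -b', by linear_combination hdet'⟩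
  have key : ∀ ℓ : ℕ, ℓ.Prime → (ℓ : ℤ) ∣ d' → (ℓ : ℤ) ∣ d - d' → False :=
    fun ℓ hℓ h1 h2 ↦ (Nat.prime_iff_prime_int.mp hℓ).not_unit (hcop12.isUnit_of_dvd' h1 h2)
  -- odd primes of `N` do not divide `2`
  have hodd2 : ∀ ℓ : ℕ, ℓ.Prime → ℓ ∣ N → ¬ (ℓ : ℤ) ∣ 2 := by
    intro ℓ hℓ hℓN h
    have h' : ℓ ∣ 2 := by exact_mod_cast h
    have := (Nat.prime_dvd_prime_iff_eq hℓ Nat.prime_two).mp h'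
    exact h2N (this ▸ hℓN)
  -- Case 1: `z = y' - y` is good
  by_cases h1 : IsCoprime (d - 2 * d') (N : ℤ)
  · refine ⟨b - 2 * b', d - 2 * d', ⟨d', -b', by linear_combination hdet'⟩, h1, by omega, ?_⟩
    have : (d - 2 * d') * b - (b - 2 * b') * d = -2 := by linear_combination (-2 : ℤ) * hdet'
    rw [this]; norm_num
  -- otherwise a prime `ℓ₀ ∣ N` divides `d - 2d'`; it divides neither `d'` nor `d - d'`
  obtain ⟨ℓ₀, hℓ₀, hℓ₀N, hℓ₀z⟩ := exists_prime_dvd_of_not_isCoprime h1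
  have hℓ₀d' : ¬ (ℓ₀ : ℤ) ∣ d' := fun h ↦
    key ℓ₀ hℓ₀ h (by have := dvd_add hℓ₀z h; rwa [show d - 2 * d' + d' = d - d' by ring] at this)
  have hℓ₀d'' : ¬ (ℓ₀ : ℤ) ∣ d - d' := fun h ↦
    key ℓ₀ hℓ₀ (by have := dvd_sub h hℓ₀z; rwa [show d - d' - (d - 2 * d') = d' by ring] at this) h
  obtain ⟨ℓ₁, hℓ₁, hℓ₁N, hℓ₁d⟩ := exists_prime_dvd_of_not_isCoprime hgy
  obtain ⟨ℓ₂, hℓ₂, hℓ₂N, hℓ₂d⟩ := exists_prime_dvd_of_not_isCoprime hgy'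
  have hne12 : ℓ₁ ≠ ℓ₂ := fun h ↦ key ℓ₁ hℓ₁ hℓ₁d (h ▸ hℓ₂d)
  have hne01 : ℓ₀ ≠ ℓ₁ := fun h ↦ hℓ₀d' (h ▸ hℓ₁d)
  have hne02 : ℓ₀ ≠ ℓ₂ := fun h ↦ hℓ₀d'' (h ▸ hℓ₂d)
  -- every prime of `N` is one of `ℓ₀, ℓ₁, ℓ₂` (three distinct primes among the three names `p, q, r`)
  have hall : ∀ ℓ : ℕ, ℓ.Prime → ℓ ∣ N → ℓ = ℓ₀ ∨ ℓ = ℓ₁ ∨ ℓ = ℓ₂ := by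
    intro ℓ hℓ hℓN
    have e0 := hpqr ℓ₀ hℓ₀ hℓ₀N
    have e1 := hpqr ℓ₁ hℓ₁ hℓ₁N
    have e2 := hpqr ℓ₂ hℓ₂ hℓ₂N
    have e := hpqr ℓ hℓ hℓN
    -- pigeonhole on three names
    rcases e with rfl | rfl | rfl <;> rcases e0 with h0 | h0 | h0 <;> rcases e1 with h1 | h1 | h1 <;>
      rcases e2 with h2 | h2 | h2 <;>
      first
        | exact Or.inl h0.symm | exact Or.inr (Or.inl h1.symm) | exact Or.inr (Or.inr h2.symm)
        | exact (hne01 (h0.trans h1.symm)).elim | exact (hne02 (h0.trans h2.symm)).elim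
        | exact (hne12 (h1.trans h2.symm)).elim
  -- goodness test for the two candidates
  have good_of : ∀ dz : ℤ, ¬ (ℓ₀ : ℤ) ∣ dz → ¬ (ℓ₁ : ℤ) ∣ dz → ¬ (ℓ₂ : ℤ) ∣ dz → IsCoprime dz (N : ℤ) := by
    intro dz h0 h1 h2
    refine isCoprime_of_forall_prime fun ℓ hℓ hℓN hℓz ↦ ?_
    rcases hall ℓ hℓ hℓN with rfl | rfl | rfl
    · exact h0 hℓz
    · exact h1 hℓz
    · exact h2 hℓz
  have hp0 : Prime (ℓ₀ : ℤ) := Nat.prime_iff_prime_int.mp hℓ₀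
  have hp1 : Prime (ℓ₁ : ℤ) := Nat.prime_iff_prime_int.mp hℓ₁
  have hp2 : Prime (ℓ₂ : ℤ) := Nat.prime_iff_prime_int.mp hℓ₂
  by_cases hsz : d' < 2 * (d - d')
  · -- Case 2: `z = y' - 2y = (b - 3b', d - 3d')`, determinant distance `3`
    refine ⟨b - 3 * b', d - 3 * d', ⟨d', -b', by linear_combination hdet'⟩, ?_, by omega, ?_⟩
    · refine good_of _ ?_ ?_ ?_
      · -- `ℓ₀ ∣ d - 3d'` with `ℓ₀ ∣ d - 2d'` gives `ℓ₀ ∣ d'`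
        intro h
        exact hℓ₀d' (by have := dvd_sub hℓ₀z h; rwa [show d - 2 * d' - (d - 3 * d') = d' by ring] at this)
      · -- `ℓ₁ ∣ d'`, so `ℓ₁ ∣ d - 3d'` gives `ℓ₁ ∣ d - d'`
        intro h
        exact key ℓ₁ hℓ₁ hℓ₁d (by have := dvd_add h (hℓ₁d.mul_left 2); rwa [show d - 3 * d' + 2 * d' = d - d' by ring] at this)
      · -- `ℓ₂ ∣ d - d'`, so `ℓ₂ ∣ d - 3d'` gives `ℓ₂ ∣ 2 d'`, hence `ℓ₂ ∣ d'`
        intro h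
        have h2d : (ℓ₂ : ℤ) ∣ 2 * d' := by
          have := dvd_sub hℓ₂d h; rwa [show d - d' - (d - 3 * d') = 2 * d' by ring] at this
        rcases hp2.dvd_or_dvd h2d with h2 | h2
        · exact hodd2 ℓ₂ hℓ₂ hℓ₂N h2
        · exact key ℓ₂ hℓ₂ h2 hℓ₂d
    · have : (d - 3 * d') * b - (b - 3 * b') * d = -3 := by linear_combination (-3 : ℤ) * hdet'
      rw [this]; rfl
  · -- Case 3: `z = 2y' - y = (2b - 3b', 2d - 3d')`, determinant distance `3`
    refine ⟨2 * b - 3 * b', 2 * d - 3 * d', ⟨d - d', -(b - b'), by linear_combination hdet'⟩, ?_, by omega, ?_⟩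
    · refine good_of _ ?_ ?_ ?_
      · -- `ℓ₀ ∣ 2d - 3d'` with `ℓ₀ ∣ 2(d - 2d')` gives `ℓ₀ ∣ d'`
        intro h
        exact hℓ₀d' (by have := dvd_sub h (hℓ₀z.mul_left 2); rwa [show 2 * d - 3 * d' - 2 * (d - 2 * d') = d' by ring] at this)
      · -- `ℓ₁ ∣ d'`, so `ℓ₁ ∣ 2d - 3d'` gives `ℓ₁ ∣ 2(d - d')`, hence `ℓ₁ ∣ d - d'`
        intro h
        have h2d : (ℓ₁ : ℤ) ∣ 2 * (d - d') := by
          have := dvd_add h (hℓ₁d.mul_left 1); rwa [show 2 * d - 3 * d' + 1 * d' = 2 * (d - d') by ring] at this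
        rcases hp1.dvd_or_dvd h2d with h2 | h2
        · exact hodd2 ℓ₁ hℓ₁ hℓ₁N h2
        · exact key ℓ₁ hℓ₁ hℓ₁d h2
      · -- `ℓ₂ ∣ d - d'`, so `ℓ₂ ∣ 2d - 3d'` gives `ℓ₂ ∣ d'`
        intro h
        exact key ℓ₂ hℓ₂ (by have := dvd_sub (hℓ₂d.mul_left 2) h; rwa [show 2 * (d - d') - (2 * d - 3 * d') = d' by ring] at this) hℓ₂d
    · have : (2 * d - 3 * d') * b - (2 * b - 3 * b') * d = -3 := by linear_combination (-3 : ℤ) * hdet'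
      rw [this]; rfl

end Rows

end Summit.BirchSwinnertonDyer.BirchSwinnertonDyer.Theorems.SignedMuAtTwo
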